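import Summits.Ventures.PercRepro.S2NuFourDeletion
import Summits.Ventures.PercRepro.S2BasesTriangles

/-!
# PercRepro — S2: RANK-`1` TRIPLES AT NULLITY `3`, THE DEPENDENT AND THE RANK-`2` `4`-SETS OF A SIMPLE MATROID (p7, gen 18; sub-claim S2;
the counts of the cases `(III)` and `(IV)` of `ν = 4`)

**`ncard_three_eRk_le_one_le_one`** — a loopless coloop-free matroid of dual rank `3` on `≥ 7` points has at most one rank-`1` triple
(two would span `≥ 4` points of rank `≤ 2`, rank `1` when they meet, against the nullity budget of S2NuFourDeletion).
**`ncard_dep_four_le_of_simple`** — the dependent `4`-sets of a simple matroid of dual rank `ν` contain a `3`-circuit or are `4`-circuits: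
`≤ C(ν + 2, 3)·(|E| − 3) + C(ν + 3, 4)` (the kit's circuit count). **`ncard_four_eRk_le_two_le_of_simple`** — its rank-`≤ 2` `4`-sets are a
`3`-circuit `C` plus a point of the line `cl(C)`, which has `≤ ν − 1` further points: `≤ (ν − 1)·C(ν + 2, 3)`.
Nothing about any cell is claimed. Axioms: standard.
-/

open scoped Matroid

namespace PercRepro

namespace S2

open Set

variable {α : Type}

/-- A nonempty subset of the ground set of a loopless matroid has rank `≥ 1`. -/
theorem one_le_eRk_of_nonempty (N : Matroid α) (hL : ∀ e ∈ N.E, ¬ N.IsLoop e) {X : Set α} (hX : X ⊆ N.E)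
    (hne : X.Nonempty) : 1 ≤ N.eRk X := by
  obtain ⟨x, hx⟩ := hne
  have hnl : N.IsNonloop x := (Matroid.not_isLoop_iff (hX hx)).1 (hL x (hX hx))
  calc (1 : ℕ∞) = N.eRk {x} := hnl.eRk_eq.symm
    _ ≤ N.eRk X := N.eRk_mono (Set.singleton_subset_iff.2 hx)

/-- **At most one rank-`1` triple** in a loopless coloop-free matroid of dual rank `3` with `≥ 7` points: two of them would
span a set of `≥ 4` points and rank `≤ 2` (rank `1` when they meet), against the nullity budget. -/
theorem ncard_three_eRk_le_one_le_one (N : Matroid α) [N.Finite] (hν : N✶.eRank = ((3 : ℕ) : ℕ∞))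
    (hL : ∀ e ∈ N.E, ¬ N.IsLoop e) (hK : ∀ e, ¬ N.IsColoop e) (hn : 7 ≤ N.E.ncard) :
    {X : Set α | X ⊆ N.E ∧ X.ncard = 3 ∧ N.eRk X ≤ 1}.ncard ≤ 1 := by
  classical
  rw [Set.ncard_le_one_iff (N.ground_finite.finite_subsets.subset (fun X hX => hX.1))]
  rintro X Y ⟨hXE, hX3, hXr⟩ ⟨hYE, hY3, hYr⟩
  by_contra hne
  have hXfin : X.Finite := N.ground_finite.subset hXE
  have hYfin : Y.Finite := N.ground_finite.subset hYE
  have hUE : X ∪ Y ⊆ N.E := Set.union_subset hXE hYE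
  have hUfin : (X ∪ Y).Finite := hXfin.union hYfin
  have hU6 : (X ∪ Y).ncard ≤ 6 := by
    have := Set.ncard_union_le X Y
    omega
  -- a point outside `X ∪ Y`
  obtain ⟨e, he, heU⟩ : ∃ e ∈ N.E, e ∉ X ∪ Y := by
    by_contra h
    push Not at h
    have : N.E ⊆ X ∪ Y := fun x hx => h x hx
    have := Set.ncard_le_ncard this hUfin
    omega
  have hbud := encard_add_one_le_eRk_add_of_not_isColoop N hν hUE he heU (hK e)
  have hr2 : N.eRk (X ∪ Y) ≤ 2 := by
    calc N.eRk (X ∪ Y) ≤ N.eRk X + N.eRk Y := N.eRk_union_le_eRk_add_eRk X Y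
      _ ≤ 1 + 1 := add_le_add hXr hYr
      _ = 2 := by norm_num
  have hU4 : (X ∪ Y).ncard ≤ 4 := by
    have h := hbud.trans (add_le_add_left hr2 _)
    rw [← hUfin.cast_ncard_eq] at h
    norm_num at h
    have h' : (X ∪ Y).ncard + 1 ≤ 5 := by exact_mod_cast h
    omega
  have hXY : X.ncard + Y.ncard = (X ∪ Y).ncard + (X ∩ Y).ncard := (Set.ncard_union_add_ncard_inter X Y hXfin hYfin).symm
  have hI2 : 2 ≤ (X ∩ Y).ncard := by omega
  have hIne : (X ∩ Y).Nonempty := by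
    rw [← Set.ncard_pos (hXfin.inter_of_left Y)]
    omega
  have hsub := N.eRk_inter_add_eRk_union_le X Y
  have hI1 := one_le_eRk_of_nonempty N hL (Set.inter_subset_left.trans hXE) hIne
  have hr1 : N.eRk (X ∪ Y) ≤ 1 := by
    have h1 : N.eRk (X ∩ Y) + N.eRk (X ∪ Y) ≤ 2 := hsub.trans (by
      calc N.eRk X + N.eRk Y ≤ 1 + 1 := add_le_add hXr hYr
        _ = 2 := by norm_num)
    have h2 : 1 + N.eRk (X ∪ Y) ≤ 2 := (add_le_add_left hI1 _).trans h1
    have h3 : 1 + N.eRk (X ∪ Y) ≤ 1 + 1 := by rw [show (2 : ℕ∞) = 1 + 1 by norm_num] at h2; exact h2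
    exact (ENat.add_le_add_iff_left (by decide)).1 h3
  have hU3 : (X ∪ Y).ncard ≤ 3 := by
    have h := hbud.trans (add_le_add_left hr1 _)
    rw [← hUfin.cast_ncard_eq] at h
    norm_num at h
    have h' : (X ∪ Y).ncard + 1 ≤ 4 := by exact_mod_cast h
    omega
  have hXU : X.ncard ≤ (X ∪ Y).ncard := Set.ncard_le_ncard Set.subset_union_left hUfin
  have hXeq : X = X ∪ Y := Set.eq_of_subset_of_ncard_le Set.subset_union_left (by omega) hUfin
  have hYeq : Y = X ∪ Y := Set.eq_of_subset_of_ncard_le Set.subset_union_right (by omega) hUfin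
  exact hne (hXeq.trans hYeq.symm)

/-- **The dependent `4`-sets of a simple finite matroid** `N` (loopless, no `2`-circuits) with `N✶.eRank = ν`: each contains a
`3`-circuit or is a `4`-circuit, so there are at most `C(ν + 2, 3)·(|E| − 3) + C(ν + 3, 4)` of them. -/
theorem ncard_dep_four_le_of_simple (N : Matroid α) [N.Finite] {ν : ℕ} (hν : N✶.eRank = (ν : ℕ∞))
    (hL : ∀ e ∈ N.E, ¬ N.IsLoop e) (hs : ∀ X ⊆ N.E, X.ncard = 2 → N.Indep X) :
    {X : Set α | X ⊆ N.E ∧ X.ncard = 4 ∧ N.Dep X}.ncard ≤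
      (ν + 2).choose 3 * (N.E.ncard - 3) + (ν + 3).choose 4 := by
  classical
  set A : Set (Set α) := ⋃ C ∈ Matroid.circF N 3, {X : Set α | X ⊆ N.E ∧ X.ncard = 4 ∧ C ⊆ X} with hA
  have hcover : {X : Set α | X ⊆ N.E ∧ X.ncard = 4 ∧ N.Dep X} ⊆ A ∪ {C : Set α | N.IsCircuit C ∧ C.ncard = 4} := by
    rintro X ⟨hXE, hX4, hXdep⟩
    have hXfin : X.Finite := N.ground_finite.subset hXE
    obtain ⟨C, hCX, hC⟩ := hXdep.exists_isCircuit_subset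
    have hCfin : C.Finite := hXfin.subset hCX
    have hC4 : C.ncard ≤ 4 := by
      have := Set.ncard_le_ncard hCX hXfin
      omega
    have hC1 : C.ncard ≠ 1 := by
      intro h1
      obtain ⟨e, rfl⟩ := Set.ncard_eq_one.1 h1
      exact hL e (hC.subset_ground (Set.mem_singleton e)) (Matroid.singleton_isCircuit.1 hC)
    have hC0 : C.ncard ≠ 0 := by
      intro h0
      rw [Set.ncard_eq_zero hCfin] at h0
      exact hC.nonempty.ne_empty h0
    have hC2 : C.ncard ≠ 2 := fun h2 => hC.dep.not_indep (hs C hC.subset_ground h2)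
    rcases (show C.ncard = 3 ∨ C.ncard = 4 by omega) with h | h
    · exact Or.inl (Set.mem_iUnion₂.2 ⟨C, Matroid.mem_circF.2 ⟨hC, h⟩, hXE, hX4, hCX⟩)
    · have hCeq : C = X := Set.eq_of_subset_of_ncard_le hCX (by omega) hXfin
      exact Or.inr ⟨hCeq ▸ hC, hX4⟩
  have hAfin : A.Finite := N.ground_finite.finite_subsets.subset (fun X hX => by
    obtain ⟨C, -, hX⟩ := Set.mem_iUnion₂.1 hX
    exact hX.1)
  have h4fin : {C : Set α | N.IsCircuit C ∧ C.ncard = 4}.Finite :=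
    N.ground_finite.finite_subsets.subset (fun C hC => hC.1.subset_ground)
  have hAle : A.ncard ≤ {C : Set α | N.IsCircuit C ∧ C.ncard = 3}.ncard * (N.E.ncard - 3) := by
    calc A.ncard ≤ ∑ C ∈ Matroid.circF N 3, {X : Set α | X ⊆ N.E ∧ X.ncard = 4 ∧ C ⊆ X}.ncard :=
          Finset.set_ncard_biUnion_le (Matroid.circF N 3) _
      _ ≤ ∑ _C ∈ Matroid.circF N 3, (N.E.ncard - 3) := by
          refine Finset.sum_le_sum (fun C hC => ?_)
          obtain ⟨hCc, hC3⟩ := Matroid.mem_circF.1 hC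
          have h := ncard_subsets_superset_le N hCc.subset_ground 4
          rw [hC3] at h
          exact h.trans (by rw [Nat.choose_one_right])
      _ = {C : Set α | N.IsCircuit C ∧ C.ncard = 3}.ncard * (N.E.ncard - 3) := by
          rw [Finset.sum_const, smul_eq_mul, Matroid.card_circF]
  have hc3 := Matroid.ncard_circuits_le_choose N hν 2
  have hc4 := Matroid.ncard_circuits_le_choose N hν 3
  norm_num at hc3 hc4
  have hu := Set.ncard_le_ncard hcover (hAfin.union h4fin)
  have hu1 := Set.ncard_union_le A {C : Set α | N.IsCircuit C ∧ C.ncard = 4}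
  calc {X : Set α | X ⊆ N.E ∧ X.ncard = 4 ∧ N.Dep X}.ncard
      ≤ A.ncard + {C : Set α | N.IsCircuit C ∧ C.ncard = 4}.ncard := hu.trans hu1
    _ ≤ {C : Set α | N.IsCircuit C ∧ C.ncard = 3}.ncard * (N.E.ncard - 3) + (ν + 3).choose 4 := by gcongr
    _ ≤ (ν + 2).choose 3 * (N.E.ncard - 3) + (ν + 3).choose 4 := by gcongr

/-- **The rank-`≤ 2` `4`-sets of a simple finite matroid** with `N✶.eRank = ν`: each is a `3`-circuit `C` plus a point of the line
`cl(C)` (at most `ν − 1` further points, the nullity budget of a rank-`2` set), so there are at most `(ν − 1)·C(ν + 2, 3)` of them. -/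
theorem ncard_four_eRk_le_two_le_of_simple (N : Matroid α) [N.Finite] {ν : ℕ} (hν : N✶.eRank = (ν : ℕ∞))
    (hL : ∀ e ∈ N.E, ¬ N.IsLoop e) (hs : ∀ X ⊆ N.E, X.ncard = 2 → N.Indep X) :
    {X : Set α | X ⊆ N.E ∧ X.ncard = 4 ∧ N.eRk X ≤ 2}.ncard ≤ (ν - 1) * (ν + 2).choose 3 := by
  classical
  set A : Set (Set α) := ⋃ C ∈ Matroid.circF N 3, {X : Set α | X ⊆ N.E ∧ X.ncard = 4 ∧ C ⊆ X ∧ X ⊆ N.closure C} with hA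
  have hcover : {X : Set α | X ⊆ N.E ∧ X.ncard = 4 ∧ N.eRk X ≤ 2} ⊆ A := by
    rintro X ⟨hXE, hX4, hXr⟩
    have hXfin : X.Finite := N.ground_finite.subset hXE
    have hXdep : N.Dep X := by
      rw [← Matroid.eRk_lt_encard_iff_dep_of_finite hXfin hXE, ← hXfin.cast_ncard_eq, hX4]
      exact hXr.trans_lt (by norm_num)
    obtain ⟨C, hCX, hC⟩ := hXdep.exists_isCircuit_subset
    have hCfin : C.Finite := hXfin.subset hCX
    have hC4 : C.ncard ≤ 4 := by
      have := Set.ncard_le_ncard hCX hXfin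
      omega
    have hC1 : C.ncard ≠ 1 := by
      intro h1
      obtain ⟨e, rfl⟩ := Set.ncard_eq_one.1 h1
      exact hL e (hC.subset_ground (Set.mem_singleton e)) (Matroid.singleton_isCircuit.1 hC)
    have hC0 : C.ncard ≠ 0 := by
      intro h0
      rw [Set.ncard_eq_zero hCfin] at h0
      exact hC.nonempty.ne_empty h0
    have hC2 : C.ncard ≠ 2 := fun h2 => hC.dep.not_indep (hs C hC.subset_ground h2)
    have hC4' : C.ncard ≠ 4 := by
      intro h4
      have hCeq : C = X := Set.eq_of_subset_of_ncard_le hCX (by omega) hXfin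
      -- a `4`-circuit has rank `3`
      have := hC.eRk_add_one_eq
      rw [hCeq, ← hXfin.cast_ncard_eq, hX4] at this
      have h3 : N.eRk X + 1 ≤ 2 + 1 := add_le_add_left hXr 1
      rw [this] at h3
      norm_num at h3
    have hC3 : C.ncard = 3 := by omega
    -- `X ⊆ cl(C)`: `C` has rank `2` and `X ⊇ C` has rank `≤ 2`
    have hXcl : X ⊆ N.closure C := by
      have hCr : N.eRk C = 2 := by
        have := hC.eRk_add_one_eq
        rw [← hCfin.cast_ncard_eq, hC3] at this
        have h := this
        norm_num at h
        exact (WithTop.add_right_cancel (WithTop.one_ne_top) (by rw [h]; norm_num : N.eRk C + 1 = (2 : ℕ∞) + 1))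
      intro x hx
      by_contra hxc
      have hxE : x ∈ N.E := hXE hx
      have h1 : N.eRk (insert x C) = N.eRk C + 1 := Matroid.eRk_insert_eq_add_one ⟨hxE, hxc⟩
      have h2 : N.eRk (insert x C) ≤ N.eRk X := N.eRk_mono (Set.insert_subset hx hCX)
      rw [h1, hCr] at h2
      have := h2.trans hXr
      norm_num at this
    exact Set.mem_iUnion₂.2 ⟨C, Matroid.mem_circF.2 ⟨hC, hC3⟩, hXE, hX4, hCX, hXcl⟩
  have hAfin : A.Finite := N.ground_finite.finite_subsets.subset (fun X hX => by
    obtain ⟨C, -, hX⟩ := Set.mem_iUnion₂.1 hX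
    exact hX.1)
  -- each `3`-circuit lies in at most `ν − 1` such `4`-sets: `X ↦ X ∖ C` injects into `(cl(C) ∩ E) ∖ C`, a set of `≤ ν − 1` points
  have hAle : A.ncard ≤ {C : Set α | N.IsCircuit C ∧ C.ncard = 3}.ncard * (ν - 1) := by
    calc A.ncard ≤ ∑ C ∈ Matroid.circF N 3, {X : Set α | X ⊆ N.E ∧ X.ncard = 4 ∧ C ⊆ X ∧ X ⊆ N.closure C}.ncard :=
          Finset.set_ncard_biUnion_le (Matroid.circF N 3) _
      _ ≤ ∑ _C ∈ Matroid.circF N 3, (ν - 1) := by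
          refine Finset.sum_le_sum (fun C hC => ?_)
          obtain ⟨hCc, hC3⟩ := Matroid.mem_circF.1 hC
          have hCE : C ⊆ N.E := hCc.subset_ground
          have hCfin : C.Finite := N.ground_finite.subset hCE
          have hCr : N.eRk C = 2 := by
            have := hCc.eRk_add_one_eq
            rw [← hCfin.cast_ncard_eq, hC3] at this
            have h := this
            norm_num at h
            exact (WithTop.add_right_cancel (WithTop.one_ne_top) (by rw [h]; norm_num : N.eRk C + 1 = (2 : ℕ∞) + 1))
          -- the line through `C` has at most `2 + ν` points
          set L := N.closure C ∩ N.E with hLdef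
          have hLE : L ⊆ N.E := Set.inter_subset_right
          have hLfin : L.Finite := N.ground_finite.subset hLE
          have hLr : N.eRk L = 2 := by
            refine le_antisymm ?_ ?_
            · calc N.eRk L ≤ N.eRk (N.closure C) := N.eRk_mono Set.inter_subset_left
                _ = N.eRk C := N.eRk_closure_eq C
                _ = 2 := hCr
            · rw [← hCr]
              exact N.eRk_mono (Set.subset_inter (N.subset_closure C hCE) hCE)
          have hLcard : L.ncard ≤ 2 + ν := by
            have h := encard_le_eRk_add_of_dual_eRank N hν hLE
            rw [hLr, ← hLfin.cast_ncard_eq] at h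
            exact_mod_cast h
          have hCL : C ⊆ L := Set.subset_inter (N.subset_closure C hCE) hCE
          have hLC : (L \ C).ncard ≤ ν - 1 := by
            have := Set.ncard_sdiff_add_ncard_of_subset hCL hLfin
            omega
          -- injection `X ↦ X ∖ C` into the `1`-subsets of `L ∖ C`
          calc {X : Set α | X ⊆ N.E ∧ X.ncard = 4 ∧ C ⊆ X ∧ X ⊆ N.closure C}.ncard
              ≤ {Y : Set α | Y ⊆ L \ C ∧ Y.ncard = 1}.ncard := by
                refine Set.ncard_le_ncard_of_injOn (fun X => X \ C) ?_ ?_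
                  ((hLfin.sdiff).finite_subsets.subset (fun Y hY => hY.1))
                · rintro X ⟨hXE, hX4, hCX, hXcl⟩
                  refine ⟨Set.sdiff_subset_sdiff_left (Set.subset_inter hXcl hXE), ?_⟩
                  rw [Set.ncard_sdiff hCX (N.ground_finite.subset (hCX.trans hXE)), hX4, hC3]
                · rintro X₁ ⟨-, -, hCX₁, -⟩ X₂ ⟨-, -, hCX₂, -⟩ hEq
                  simp only at hEq
                  rw [← Set.sdiff_union_of_subset hCX₁, ← Set.sdiff_union_of_subset hCX₂, hEq]
            _ = (L \ C).ncard.choose 1 := ncard_subsets_ncard_eq (L \ C) hLfin.sdiff 1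
            _ ≤ ν - 1 := by rw [Nat.choose_one_right]; exact hLC
      _ = {C : Set α | N.IsCircuit C ∧ C.ncard = 3}.ncard * (ν - 1) := by
          rw [Finset.sum_const, smul_eq_mul, Matroid.card_circF]
  have hc3 := Matroid.ncard_circuits_le_choose N hν 2
  norm_num at hc3
  calc {X : Set α | X ⊆ N.E ∧ X.ncard = 4 ∧ N.eRk X ≤ 2}.ncard ≤ A.ncard := Set.ncard_le_ncard hcover hAfin
    _ ≤ {C : Set α | N.IsCircuit C ∧ C.ncard = 3}.ncard * (ν - 1) := hAle
    _ ≤ (ν + 2).choose 3 * (ν - 1) := by gcongr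
    _ = (ν - 1) * (ν + 2).choose 3 := by ring

end S2

end PercRepro
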